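import Summits.BirchSwinnertonDyer.BirchSwinnertonDyer.Theorems.KatoDescentPotSupersingularFineSelmerLeSelmer
import Summits.BirchSwinnertonDyer.Rank1Residual.Iwasawa.DualPairFiniteResidue
import Summits.BirchSwinnertonDyer.Rank1Residual.Iwasawa.MuZeroQuotientCard
import Summits.BirchSwinnertonDyer.Rank1Residual.X2.NonPrimitiveSelmerTorsionCard
import Summits.BirchSwinnertonDyer.BirchSwinnertonDyer.Theorems.KatoDescentPotSupersingularWildFineSelmerCongruenceRoad
import Summits.BirchSwinnertonDyer.Rank1Residual.Additive.PotSupersingularClasses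
import Literature.NumberTheory.EllipticCurves.KatoFineSelmerFiniteProofs
import Literature.NumberTheory.EllipticCurves.Kato2004.AdditivePotGoodRankZeroShaUpperBoundFineSelmer
import HarnessLib

/-!
# Route `KatoDescentPotSupersingular` (rung K9, cell `bsd-potss`): ORDINARY (indeed arbitrary) ANCHORS for
# the congruence road to the Conj-A crux `WildFineSelmerCoatesSujatha` (item stmt-BirchSwinnertonDyer-19386)
# — Coates–Sujatha's (A) at `(E′,p)` IN THE KERNEL from the finiteness of `Sel_{p^∞}(E′/K_∞)[p]`
# (classical `μ = 0` with cotorsion); ROUTE-FREE (a `--supports … --as helper` file; seat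
# `bsd-potss-k9-c4` g3; nothing booked, BSD is not proved by any of this)

THE ROAD SO FAR (`…WildFineSelmerCongruenceRoad.lean`, `…FineSelmerLeSelmer.lean`, this seat): on a row
`W` of the crux (irreducible `W[3]`, tower not onto), (A) at `(W,3)` ⟸ (A) at `(W′,3)` for ONE curve
`W′` with `W′[3] ≃ W[3]` (Lim–Sujatha 2018 Prop. 3.2). o6-r1's Kato unit anchors serve the 20 Elkies
rows; the 344 Cartan-normaliser rows admit no Kato anchor (same mod-3 image). THIS FILE makes the
second anchor type usable in the kernel: **(A) at `(W′,p)` holds as soon as the `p`-torsion of the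
CLASSICAL Selmer group `Sel_{p^∞}(W′/K_∞)` is finite** (`conjA_of_finite_selmerInfty_pTorsion`; any
number field, any `p`, any `ℤ_p`-extension with a topological generator): `Sel₀ ≤ Sel`
(`FineSelmerLeSelmer.fineSelmerInfty_le_selmerInfty`) ⟹ `Sel₀[p]` finite ⟹ `X₀/(p)X₀` finite
(`FineSelmerDualData.finite_quotient_augIdealP_of_finite_pTorsion`) ⟹ with `X₀` finitely generated
over `Λ` (`FineSelmerDualData.module_finite`) it is `Λ`-torsion (`Iwasawa.isTorsion_of_finite_modN`) of
`μ = 0` (`X2.MuVanishingOfFiniteModP`) hence finitely generated over `ℤ_p`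
(`X2.NonPrimitiveSelmerTorsionCard.moduleFinite_int_of_muInvariant_eq_zero`).  For a curve `W′/ℚ`
with GOOD ORDINARY reduction at `p` the hypothesis "`Sel_{p^∞}(W′/ℚ^cyc)[p]` finite" is
Greenberg–Vatsal's `μ^alg = 0` with cotorsion (Prop. (2.8)), certified per curve by Greenberg's
Thm. 4.1 (tree: `SelmerDualData.constantCoeff_charGenerator_mul_natCard_of_finite_selmerGroup_of_ordinary`)
or by Kato 17.4 + `μ_an = 0`; the image of `W′[p]` plays no role, which is what breaks the symmetry
that voids every `E[p]`-only criterion on the ♯ rows.  Consequences recorded: the row form of the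
road with an ordinary-type anchor (`missingUpperBoundAt_wild_of_congruent_of_finite_selmerInfty_pTorsion`)
and the per-row certificate shape for the crux body. CONDITIONAL on the displayed named facts (Kato's
fine-Selmer reading p420034, GZK, modularity, Lim–Sujatha carried inline as `hLS`); item 19386 is NOT
closed; no census number is an input.

References: [LimSujatha2018] §3 Prop. 3.2; [CoatesSujatha2005] §3; [GreenbergVatsal2000] Prop. (2.8),
Thm. (1.4); [GreenbergLNM1716] Thm. 4.1; [Kato2004Asterisque] Thm. 14.5 (3), 17.4; [Miller2011LMS] Def. 1.1.
-/

set_option autoImplicit false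
-- sibling precedent (`KatoDescentPotSupersingularAssembly.lean`): the directory name repeats the summit name
set_option linter.dupNamespace false

noncomputable section

open scoped Classical

universe u

namespace Summit.BirchSwinnertonDyer.BirchSwinnertonDyer.Theorems.WildFineSelmerOrdinaryAnchor

open WeierstrassCurve Literature.NumberTheory.EllipticCurves
  Literature.NumberTheory.EllipticCurves.IwasawaAlgebra
  Literature.NumberTheory.EllipticCurves.Rank1Residual
  Literature.NumberTheory.EllipticCurves.Rank1Residual.Typed
  Summit.BirchSwinnertonDyer.Rank1Residual Summit.BirchSwinnertonDyer.Rank1Residual.Additive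
  Summit.BirchSwinnertonDyer.Rank1Residual.O6
  Summit.BirchSwinnertonDyer.BirchSwinnertonDyer.Theorems

/-! ## §1 (A) at `(W′, p)` from the finiteness of `Sel_{p^∞}(W′/K_∞)[p]` -/

/-- **Coates–Sujatha's (A) in the kernel from classical `μ = 0` (with cotorsion).** For an elliptic
curve `W/K` over a number field, a prime `p`, a `ℤ_p`-extension `κ` with topological generator `γ`:
if the `p`-torsion classes of the classical Selmer group `Sel_{p^∞}(W/K_∞)` form a finite set
(Greenberg–Vatsal Prop. (2.8): `X(W/K_∞)` is `Λ`-torsion with `μ = 0`), then the Pontryagin dual of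
the fine Selmer group is finitely generated over `ℤ_p` — (A) at `(W,p)` over `K_∞`, in the tree's
`∃`-form. Chain: `Sel₀ ≤ Sel` (this seat's bridge) ⟹ `Sel₀[p]` finite ⟹ `X₀/(p)` finite ⟹ (`X₀`
f.g./`Λ`) torsion with `μ(X₀) = 0` ⟹ f.g./`ℤ_p`. Unconditional kernel theorem.
[cite: GreenbergVatsal2000, §2 Prop. (2.8) (p. 25)] [cite: CoatesSujatha2005, §3] -/
theorem conjA_of_finite_selmerInfty_pTorsion {K : Type u} [Field K] [NumberField K]
    (W : WeierstrassCurve K) [W.IsElliptic] {p : ℕ} [Fact p.Prime] (κ : ZpExtension K p)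
    {γ : Field.absoluteGaloisGroup K} (hγ : κ.IsTopGenerator γ)
    (hfin : Set.Finite {s : W.selmerInfty κ | p • s = 0}) :
    ∃ (γ' : Field.absoluteGaloisGroup K) (D : W.FineSelmerDualData κ γ'),
      Module.Finite ℤ_[p] (RestrictScalars ℤ_[p] (IwasawaAlgebra p) D.X) := by
  have h0 : Set.Finite {s : W.fineSelmerInfty κ | p • s = 0} :=
    FineSelmerLeSelmer.finite_fineSelmerInfty_pTorsion_of_finite_selmerInfty_pTorsion W κ hfin
  let D : W.FineSelmerDualData κ γ := W.fineSelmerDualData κ hγ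
  haveI hfg : Module.Finite (IwasawaAlgebra p) D.X := FineSelmerDualData.module_finite (W := W) κ hγ D
  have hq : Finite (D.X ⧸ (augIdealP p • (⊤ : Submodule (IwasawaAlgebra p) D.X))) :=
    D.finite_quotient_augIdealP_of_finite_pTorsion h0
  have hmodN : Finite (ModN D.X p) := by
    apply Nat.finite_of_card_ne_zero
    rw [← Iwasawa.natCard_quotient_augIdealP_smul_top_eq_natCard_modN p]
    exact (Nat.card_pos (α := D.X ⧸ (augIdealP p • (⊤ : Submodule (IwasawaAlgebra p) D.X)))).ne'
  haveI := hmodN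
  have hT : Module.IsTorsion (IwasawaAlgebra p) D.X := Iwasawa.isTorsion_of_finite_modN p D.X
  have hμ : muInvariant p D.X = 0 :=
    X2.MuVanishingOfFiniteModP.muInvariant_eq_zero_of_finite_modN' p D.X hT hmodN
  exact ⟨γ, D, X2.NonPrimitiveSelmerTorsionCard.moduleFinite_int_of_muInvariant_eq_zero p D.X hT hμ⟩

/-- Variant over `ℚ` quantified over all cyclotomic data, in the exact `∃`-form of the crux and of the
fine-Selmer Kato fact p420034: if for every cyclotomic `ℤ_p`-extension datum `κ` the `p`-torsion of
`Sel_{p^∞}(W/ℚ_∞)` is finite, then (A) at `(W, p)` (a topological generator always exists, `κ` being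
onto `ℤ_p`). [cite: GreenbergVatsal2000, §2 Prop. (2.8) (p. 25)] [cite: CoatesSujatha2005, §3] -/
theorem conjA_rat_of_finite_selmerInfty_pTorsion (W : WeierstrassCurve ℚ) [W.IsElliptic] {p : ℕ}
    [Fact p.Prime]
    (hfin : ∀ (κ : ZpExtension ℚ p), κ.IsCyclotomic → Set.Finite {s : W.selmerInfty κ | p • s = 0}) :
    ∀ (κ : ZpExtension ℚ p), κ.IsCyclotomic →
      ∃ (γ : Field.absoluteGaloisGroup ℚ) (D : W.FineSelmerDualData κ γ),
        Module.Finite ℤ_[p] (RestrictScalars ℤ_[p] (IwasawaAlgebra p) D.X) := by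
  intro κ hκ
  obtain ⟨γ, hγ⟩ : ∃ γ : Field.absoluteGaloisGroup ℚ, κ.IsTopGenerator γ :=
    κ.surjective (Multiplicative.ofAdd 1)
  exact conjA_of_finite_selmerInfty_pTorsion W κ hγ (hfin κ hκ)

/-! ## §2 The road with an ordinary-type anchor, under the PRINTED Lim–Sujatha statement (`p ≠ 2`) -/

section Road

/- The one published input carried INLINE, in the spelling of the Literature fact
`Literature.NumberTheory.EllipticCurves.LimSujatha2018.prop32_fineSelmerDual_moduleFinite_iff_of_torsionIso`
(this seat; review-queued at the time of writing) — WITH the source's standing restriction `p ≠ 2`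
(J. Number Theory 187 (2018) §3, p. 8 L3–5: "If `p = 2`, assume further that the number field `F`
has no real primes"; the first filing p443913 was returned for exactly this binder). Once the fact
lands, `hLS := LimSujatha2018.prop32_…` discharges it by `exact` (`O6.ModPCongruent` unfolds to the
fact's inline torsion isomorphism). The sibling road file p444006 carries the same sentence without
the `p ≠ 2` binder as ITS section hypothesis; the present spelling supersedes it for discharge. -/
variable (hLS : ∀ (W₁ W₂ : WeierstrassCurve ℚ) [W₁.IsElliptic] [W₂.IsElliptic] (p : ℕ) [Fact p.Prime],
    p ≠ 2 → ModPCongruent W₁ W₂ p → ∀ (κ : ZpExtension ℚ p), κ.IsCyclotomic →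
      ((∃ (γ : Field.absoluteGaloisGroup ℚ) (D : W₁.FineSelmerDualData κ γ),
          Module.Finite ℤ_[p] (RestrictScalars ℤ_[p] (IwasawaAlgebra p) D.X)) ↔
        ∃ (γ : Field.absoluteGaloisGroup ℚ) (D : W₂.FineSelmerDualData κ γ),
          Module.Finite ℤ_[p] (RestrictScalars ℤ_[p] (IwasawaAlgebra p) D.X)))

include hLS

/-- **Row transfer under the printed hypothesis**: (A) at `(W,p)`, `p ≠ 2`, from (A) at a congruent
`W′`. [cite: LimSujatha2018, §3 Prop. 3.2] -/
theorem conjA_of_modPCongruent_of_ne_two {W W' : WeierstrassCurve ℚ} [W.IsElliptic] [W'.IsElliptic]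
    {p : ℕ} [Fact p.Prime] (hp : p ≠ 2) (hcong : ModPCongruent W' W p)
    (hA' : ∀ (κ : ZpExtension ℚ p), κ.IsCyclotomic →
      ∃ (γ : Field.absoluteGaloisGroup ℚ) (D : W'.FineSelmerDualData κ γ),
        Module.Finite ℤ_[p] (RestrictScalars ℤ_[p] (IwasawaAlgebra p) D.X)) :
    ∀ (κ : ZpExtension ℚ p), κ.IsCyclotomic →
      ∃ (γ : Field.absoluteGaloisGroup ℚ) (D : W.FineSelmerDualData κ γ),
        Module.Finite ℤ_[p] (RestrictScalars ℤ_[p] (IwasawaAlgebra p) D.X) :=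
  fun κ hκ ↦ (hLS W' W p hp hcong κ hκ).mp (hA' κ hκ)

/-- **THE CONGRUENCE ROAD WITH AN ORDINARY-TYPE ANCHOR, row form (K9 currency).** Granted the
fine-Selmer Kato fact (`hKatoA`, p420034), GZK (`hGZK`), modularity (`hmod`) and Lim–Sujatha (`hLS`):
on an O6 row of analytic rank `0` with `W[3]` irreducible, ONE elliptic `W′/ℚ` with `W′[3] ≃ W[3]` and
FINITE `3`-torsion in its classical Selmer group over every cyclotomic `ℤ₃`-tower
(`Sel_{3^∞}(W′/ℚ^cyc)[3]` finite — for `W′` good ordinary at `3`: `μ^alg(W′) = 0` with cotorsion,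
Greenberg–Vatsal Prop. (2.8); certified per curve by Greenberg's Thm. 4.1 or Kato 17.4 + `μ_an = 0`;
NO condition on the image of `W′[3]`) gives the upper half `ord₃ #Ш(W) ≤ ord₃ #Ш_an(W)`. The Kato
A161″ conclusion comes from this seat's `x4UpperOfFineMuZero_conjA` (= p420034 at the Conj-A binding)
and is converted to Miller's currency as in o6-r1's `X4WildRankZero.missingUpperBoundAt_of_congruentUnitAnchor`.
Conditional; nothing booked. [cite: LimSujatha2018, §3 Prop. 3.2] [cite: GreenbergVatsal2000, §2 Prop. (2.8)]
[cite: Kato2004Asterisque, Thm. 14.5 (3) (p. 236), Prop. 14.16 (2) (p. 244)] [cite: Miller2011LMS, Def. 1.1] -/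
theorem missingUpperBoundAt_wild_of_congruent_of_finite_selmerInfty_pTorsion
    (hKatoA :
      Kato2004.rankZero_padicValNat_sha_add_padicValNat_tamagawa_le_of_additive_potGood_of_irreducible_of_fineSelmerDual_fg)
    (hGZK : rank_eq_analyticRank_of_analyticRank_le_one) (hmod : hasEntireLFunction_rat)
    (W : WeierstrassCurve ℚ) [W.IsElliptic] [W.IsGloballyMinimal] [Fact (3 : ℕ).Prime]
    (hr : W.analyticRank = 0) (hO : ClassO6 W 3) (hirr : W.HasIrreducibleModPGaloisRep 3)
    (hanchor : ∃ (W' : WeierstrassCurve ℚ) (_ : W'.IsElliptic), ModPCongruent W' W 3 ∧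
      ∀ (κ : ZpExtension ℚ 3), κ.IsCyclotomic → Set.Finite {s : W'.selmerInfty κ | 3 • s = 0}) :
    MissingUpperBoundAt W 3 := by
  obtain ⟨W', hW', hcong, hfin'⟩ := hanchor
  haveI := hW'
  -- (A) at `(W′, 3)` from the finiteness of `Sel(W′/ℚ^cyc)[3]`, then (A) at `(W, 3)` by Lim–Sujatha
  have hA : ∀ (κ : ZpExtension ℚ 3), κ.IsCyclotomic →
      ∃ (γ : Field.absoluteGaloisGroup ℚ) (D : W.FineSelmerDualData κ γ),
        Module.Finite ℤ_[3] (RestrictScalars ℤ_[3] (IwasawaAlgebra 3) D.X) :=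
    conjA_of_modPCongruent_of_ne_two hLS (by norm_num) hcong
      (conjA_rat_of_finite_selmerInfty_pTorsion W' hfin')
  -- Kato's A161″ conclusion at `W` (p420034 at the Conj-A binding) in Miller's currency
  have hL : W.entireLFunction 1 ≠ 0 := (W.analyticRank_eq_zero_iff_holds (hmod W)).mp hr
  obtain ⟨-, hfin⟩ := hGZK W (by rw [hr]; exact zero_le_one)
  obtain ⟨q₀, hq₀, hle⟩ := WildFineSelmerCongruence.x4UpperOfFineMuZero_conjA hKatoA W 3 hO.1 hO.2.1.1
    hO.2.1.2 hO.padicValRat_j_nonneg hirr (fun κ hκ ↦ hA κ hκ) hL hfin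
  have ht0 : padicValNat 3 W.torsionOrder = 0 := padicValNat_torsionOrder_eq_zero_of_irreducible W 3 hirr
  obtain ⟨q, hq, hle'⟩ := exists_shaAn_le_add_torsion_of_katoCurrency hGZK hmod W 3 hr hfin hq₀
    (by rw [ht0, Nat.cast_zero, mul_zero, add_zero]; exact hle)
  refine ⟨q, hq, ?_⟩
  rw [ht0, Nat.cast_zero, add_zero] at hle'
  exact hle'

/-- **The crux body from per-row ORDINARY-TYPE certificates.** If every row of
`WildFineSelmerCoatesSujatha` (item 19386) admits an elliptic `W′/ℚ` with `W′[3] ≃ W[3]` and finite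
`Sel_{3^∞}(W′/ℚ^cyc)[3]` for every cyclotomic datum, then the BODY of the route decl holds verbatim
(route-free; against the decl the term elaborates by defeq unfolding). Together with o6-r1's unit
anchors (Elkies rows) this is the per-row certificate road for ALL 364 census rows of the crux,
subject to anchor EXISTENCE per row (census task; no number is an input here). Conditional on
Lim–Sujatha (`hLS`); the item is NOT closed. [cite: LimSujatha2018, §3 Prop. 3.2]
[cite: GreenbergVatsal2000, §2 Prop. (2.8)] -/
theorem wildFineSelmerCoatesSujatha_of_ordinaryCertificates
    (hcert : ∀ (W : WeierstrassCurve ℚ) [W.IsElliptic] [W.IsGloballyMinimal] [Fact (3 : ℕ).Prime],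
      W.analyticRank = 0 → ClassO6 W 3 → W.HasIrreducibleModPGaloisRep 3 →
      ¬ (∀ n : ℕ, W.HasSurjectiveModNGaloisRep (3 ^ n : ℕ)) → ¬ W.HasCM →
      ∃ (W' : WeierstrassCurve ℚ) (_ : W'.IsElliptic), ModPCongruent W' W 3 ∧
        ∀ (κ : ZpExtension ℚ 3), κ.IsCyclotomic → Set.Finite {s : W'.selmerInfty κ | 3 • s = 0}) :
    ∀ (W : WeierstrassCurve ℚ) [W.IsElliptic] [W.IsGloballyMinimal] [Fact (3 : ℕ).Prime],
      W.analyticRank = 0 → ClassO6 W 3 → W.HasIrreducibleModPGaloisRep 3 →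
      ¬ (∀ n : ℕ, W.HasSurjectiveModNGaloisRep (3 ^ n : ℕ)) → ¬ W.HasCM →
      ∀ (κ : ZpExtension ℚ 3), κ.IsCyclotomic →
        ∃ (γ : Field.absoluteGaloisGroup ℚ) (D : W.FineSelmerDualData κ γ),
          Module.Finite ℤ_[3] (RestrictScalars ℤ_[3] (IwasawaAlgebra 3) D.X) := by
  intro W _ _ _ hr hO hirr hns hcm
  obtain ⟨W', hW', hcong, hfin'⟩ := hcert W hr hO hirr hns hcm
  haveI := hW'
  exact conjA_of_modPCongruent_of_ne_two hLS (by norm_num) hcong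
    (conjA_rat_of_finite_selmerInfty_pTorsion W' hfin')

/-- **Mixed certificates** (the shape an engine would fill): per row, a congruent `W′` carrying EITHER
(A) at `(W′,3)` outright (e.g. o6-r1's Kato unit anchors through the reading (A⋆)) OR finite
`Sel_{3^∞}(W′/ℚ^cyc)[3]` (ordinary-type anchors, this file) ⟹ the BODY of `WildFineSelmerCoatesSujatha`.
[cite: LimSujatha2018, §3 Prop. 3.2] -/
theorem wildFineSelmerCoatesSujatha_of_mixedCertificates
    (hcert : ∀ (W : WeierstrassCurve ℚ) [W.IsElliptic] [W.IsGloballyMinimal] [Fact (3 : ℕ).Prime],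
      W.analyticRank = 0 → ClassO6 W 3 → W.HasIrreducibleModPGaloisRep 3 →
      ¬ (∀ n : ℕ, W.HasSurjectiveModNGaloisRep (3 ^ n : ℕ)) → ¬ W.HasCM →
      ∃ (W' : WeierstrassCurve ℚ) (_ : W'.IsElliptic), ModPCongruent W' W 3 ∧
        ((∀ (κ : ZpExtension ℚ 3), κ.IsCyclotomic →
            ∃ (γ : Field.absoluteGaloisGroup ℚ) (D : W'.FineSelmerDualData κ γ),
              Module.Finite ℤ_[3] (RestrictScalars ℤ_[3] (IwasawaAlgebra 3) D.X)) ∨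
          ∀ (κ : ZpExtension ℚ 3), κ.IsCyclotomic → Set.Finite {s : W'.selmerInfty κ | 3 • s = 0})) :
    ∀ (W : WeierstrassCurve ℚ) [W.IsElliptic] [W.IsGloballyMinimal] [Fact (3 : ℕ).Prime],
      W.analyticRank = 0 → ClassO6 W 3 → W.HasIrreducibleModPGaloisRep 3 →
      ¬ (∀ n : ℕ, W.HasSurjectiveModNGaloisRep (3 ^ n : ℕ)) → ¬ W.HasCM →
      ∀ (κ : ZpExtension ℚ 3), κ.IsCyclotomic →
        ∃ (γ : Field.absoluteGaloisGroup ℚ) (D : W.FineSelmerDualData κ γ),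
          Module.Finite ℤ_[3] (RestrictScalars ℤ_[3] (IwasawaAlgebra 3) D.X) := by
  intro W _ _ _ hr hO hirr hns hcm
  obtain ⟨W', hW', hcong, hA' | hfin'⟩ := hcert W hr hO hirr hns hcm
  · haveI := hW'
    exact conjA_of_modPCongruent_of_ne_two hLS (by norm_num) hcong hA'
  · haveI := hW'
    exact conjA_of_modPCongruent_of_ne_two hLS (by norm_num) hcong
      (conjA_rat_of_finite_selmerInfty_pTorsion W' hfin')

end Road

end Summit.BirchSwinnertonDyer.BirchSwinnertonDyer.Theorems.WildFineSelmerOrdinaryAnchor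

end
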